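import Summits.Ventures.HSemireg.WedgeHankelOuterPairs

/-!
# Venture HSemireg — THE IMAGE OF THE SUB-BOX FORMS: `dim V(Dm M, w_N q, k) = C(M, k) · rank H_k(q)`, and for every pair set `T` the kernel / image of th-7's class on the
# `k`-forms of the letters of `T` have dimensions `C(2|T|, k) − C(|T|, k) · r_k(q)` / `C(|T|, k) · r_k(q)`; the Hankel matrix eliminated: codimensions and image
# dimensions of two pair sets are in the ratio `C(|T|, k) : C(|T'|, k)`

HONEST FRAMING. Part of the Lean index of the computation cell `pub-hsemireg` (seat p10 gen 23, Sunday typer «UNIFORM-IN-n»).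
Finite-dimensional EXTERIOR ALGEBRA over a field ONLY: no variety, no cohomology theory, no sheaf, no Ext group, no semiregularity map;
nothing here says that HC / HC_CM / HC_AV holds; no Literature fact is declared or used.  Custodian versions as in `WedgeHankelSiegelIdeal` (1/3); the dictionary (`w_N(q)` = the
class of the box on `N` pairs; the letters of `T` = the sub-product of the pairs in `T`; `H_k(q)` = the `k`-th Hankel matrix of the coefficient sequence) is QUOTED, never asserted.

WHAT IS IN THE TREE.  th-7's factor rank space `V D f k` (`WedgeKunneth`) and gen 13's `finrank_Kr_add_finrank_V` (`dim Kr(D,f,k) + dim V(D,f,k) = C(|D|,k)`); the pair index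
`pr`, `xJ` / `yJ` (`WedgeWeilPairs`); K39 (`WedgeHankelOuterValue`): `finrank_Kr_w_Dm_add`, `finrank_Kr_w_Dm_top`, `card_Dm_eq_two_mul`; K40 (`WedgeHankelOuterPairs`): `Sp_inf_Sp`,
`Sp_congr_iff`, `finrank_Kr_w_inf_Sp_pairs_add` (`dim (Kr(univ, w_N q, k) ⊓ Sp(pairs ⊆ T)) + C(|T|,k) · r_k(q) = C(2|T|, k)`).
THIS FILE (namespace `Summit.Ventures.HSemireg.Wedge.HankelOuter` continued; imports K40):
* §370 the LETTERS of a pair set `T` = `univ.filter (pr · ∈ T)`: `card_letters_eq` (`2|T|` letters), `Hom_univ_inf_Sp_pairs_eq` (`Hom(univ,k) ⊓ Sp(pairs ⊆ T) = Hom(letters T, k)`),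
  **`Kr_univ_inf_Sp_pairs_eq_Kr_letters`** (`Kr(univ,f,k) ⊓ Sp(pairs ⊆ T) = Kr(letters T, f, k)`, any class `f`): K25/K40's restricted kernel IS th-7's block kernel space of the block
  «letters of `T`».
* §371 **`finrank_V_w_Dm`: `dim V(Dm M, w_N q, k) = C(M,k) · rank (hankel1 K N k q)`** (`M ≤ N`); **`finrank_Kr_w_letters_add`** and **`finrank_V_w_letters`**: for EVERY pair set
  `T`, `dim Kr(letters T, w_N q, k) + C(|T|,k) · r_k(q) = C(2|T|, k)` and `dim V(letters T, w_N q, k) = C(|T|, k) · r_k(q)`; `finrank_V_w_letters_univ` (consistency with th-7's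
  `C(N,k) · r_k(q)` at `T = univ`).
* §372 THE HANKEL MATRIX ELIMINATED, for pair sets: **`choose_mul_codim_pairs_eq`** (`C(N,k) · codim_T = C(|T|,k) · codim_univ`), **`choose_mul_codim_pairs_eq_pairs`**
  (`C(|T'|,k) · codim_T = C(|T|,k) · codim_{T'}`) and the image form **`choose_mul_finrank_V_w_letters`** (`C(|T'|,k) · dim V_T = C(|T|,k) · dim V_{T'}`).
READING: on the sub-box of ANY `M` pairs the class `w_N(q)` has image dimension `C(M,k) · r_k(q)` and kernel codimension `C(M,k) · r_k(q)` on `k`-forms — th-7's law with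
`C(M,k)` in place of `C(N,k)` and the SAME Hankel rank.  Nothing Ext-side.  New names only.
-/

open Module

namespace Summit.Ventures.HSemireg.Wedge.HankelOuter

open Summit.Ventures.HSemireg.Wedge Summit.Ventures.HSemireg.Wedge.Kunneth Summit.Ventures.HSemireg.Wedge.Hankel
  Summit.Ventures.HSemireg.Wedge.BasisFree Summit.Ventures.HSemireg.Wedge.HankelSiegel Summit.Ventures.HSemireg.Wedge.HankelSiegelIdeal
  Summit.Ventures.HSemireg.Wedge.KunnethKernel Summit.Ventures.HSemireg.Wedge.HankelFrameChange Summit.Ventures.HSemireg.Wedge.Weil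
  Summit.Ventures.HSemireg.Wedge.HankelPairMixing

variable (K : Type*) [Field K] {N : ℕ}

/-! ## §370. The letters of a pair set -/

omit [Field K] in
/-- the letters of the pairs in `T` are the `x_c` and the `y_c`, `c ∈ T`. -/
theorem letters_eq_image_union_image (T : Finset (Fin N)) :
    (Finset.univ.filter fun i : In N => pr i ∈ T) = T.image (xJ N) ∪ T.image (yJ N) := by
  ext i
  simp only [Finset.mem_filter, Finset.mem_univ, true_and, Finset.mem_union, Finset.mem_image]
  constructor
  · intro hi
    rcases eq_xJ_or_eq_yJ i with e | e
    · exact Or.inl ⟨pr i, hi, e.symm⟩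
    · exact Or.inr ⟨pr i, hi, e.symm⟩
  · rintro (⟨c, hc, rfl⟩ | ⟨c, hc, rfl⟩)
    · rwa [pr_xJ]
    · rwa [pr_yJ]

omit [Field K] in
/-- **a pair set `T` has `2|T|` letters.** -/
theorem card_letters_eq (T : Finset (Fin N)) : (Finset.univ.filter fun i : In N => pr i ∈ T).card = T.card + T.card := by
  rw [letters_eq_image_union_image, Finset.card_union_of_disjoint, Finset.card_image_of_injective _ xJ_injective,
    Finset.card_image_of_injective _ yJ_injective]
  rw [Finset.disjoint_left]
  intro _ h1 h2
  obtain ⟨c, -, rfl⟩ := Finset.mem_image.mp h1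
  obtain ⟨d, -, e⟩ := Finset.mem_image.mp h2
  exact xJ_ne_yJ c d e.symm

/-- **`Hom(univ, k) ⊓ Sp(pairs ⊆ T) = Hom(letters T, k)`**: the `k`-forms all of whose letters lie in pairs of `T` are th-7's `Hom` of the block «letters of `T`». -/
theorem Hom_univ_inf_Sp_pairs_eq (T : Finset (Fin N)) (k : ℕ) :
    Hom K (In N) Finset.univ k ⊓ Sp K (fun s : Finset (In N) => ∀ i ∈ s, pr i ∈ T) = Hom K (In N) (Finset.univ.filter fun i : In N => pr i ∈ T) k := by
  rw [Hom_eq_Sp, Hom_eq_Sp, Sp_inf_Sp]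
  apply Sp_congr_iff
  intro s
  constructor
  · rintro ⟨⟨-, hc⟩, hp⟩
    exact ⟨fun i hi => Finset.mem_filter.mpr ⟨Finset.mem_univ _, hp i hi⟩, hc⟩
  · rintro ⟨hs, hc⟩
    exact ⟨⟨Finset.subset_univ _, hc⟩, fun i hi => (Finset.mem_filter.mp (hs hi)).2⟩

/-- **`Kr(univ, f, k) ⊓ Sp(pairs ⊆ T) = Kr(letters T, f, k)`** (any class `f`, any degree): K25/K40's restricted kernel is th-7's block kernel space of the letters of `T`. -/
theorem Kr_univ_inf_Sp_pairs_eq_Kr_letters (T : Finset (Fin N)) (f : HT K (In N)) (k : ℕ) :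
    Kr K (Finset.univ : Finset (In N)) f k ⊓ Sp K (fun s : Finset (In N) => ∀ i ∈ s, pr i ∈ T) = Kr K (Finset.univ.filter fun i : In N => pr i ∈ T) f k := by
  rw [Kr, Kr, inf_right_comm, Hom_univ_inf_Sp_pairs_eq]

/-! ## §371. The image of the sub-box forms -/

/-- **THE IMAGE OF THE SUB-BOX FORMS: `dim V(Dm M, w_N q, k) = C(M, k) · rank (hankel1 K N k q)`** (`M ≤ N`; every `k`, `q`, field): the per-degree rank–nullity on the block
`Dm M` (`2M` letters) against K39's value of the kernel. -/
theorem finrank_V_w_Dm {M : ℕ} (hM : M ≤ N) (k : ℕ) (q : ℕ → K) :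
    finrank K ↥(V K (In N) (Dm N M) (w K N N q) k) = M.choose k * (hankel1 K N k q).rank := by
  have h1 := finrank_Kr_add_finrank_V K (Dm N M) (w K N N q) k
  have h2 := finrank_Kr_w_Dm_add K hM k q
  rw [card_Dm_eq_two_mul M hM, two_mul] at h1
  omega

/-- **for EVERY pair set `T`: `dim Kr(letters T, w_N q, k) + C(|T|, k) · rank (hankel1 K N k q) = C(|T| + |T|, k)`** (K40 in block form). -/
theorem finrank_Kr_w_letters_add (T : Finset (Fin N)) (k : ℕ) (q : ℕ → K) :
    finrank K ↥(Kr K (Finset.univ.filter fun i : In N => pr i ∈ T) (w K N N q) k) + T.card.choose k * (hankel1 K N k q).rank = (T.card + T.card).choose k := by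
  rw [← Kr_univ_inf_Sp_pairs_eq_Kr_letters]
  exact finrank_Kr_w_inf_Sp_pairs_add K T k q

/-- **for EVERY pair set `T`: `dim V(letters T, w_N q, k) = C(|T|, k) · rank (hankel1 K N k q)`** — the image of the `k`-forms of the sub-box of the pairs in `T` under
`θ ↦ θ ∧ w_N(q)` has th-7's dimension with `C(|T|,k)` in place of `C(N,k)` and the SAME Hankel rank. -/
theorem finrank_V_w_letters (T : Finset (Fin N)) (k : ℕ) (q : ℕ → K) :
    finrank K ↥(V K (In N) (Finset.univ.filter fun i : In N => pr i ∈ T) (w K N N q) k) = T.card.choose k * (hankel1 K N k q).rank := by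
  have h1 := finrank_Kr_add_finrank_V K (Finset.univ.filter fun i : In N => pr i ∈ T) (w K N N q) k
  have h2 := finrank_Kr_w_letters_add K T k q
  rw [card_letters_eq] at h1
  omega

omit [Field K] in
/-- all letters: `letters univ = univ`. -/
theorem letters_univ : (Finset.univ.filter fun i : In N => pr i ∈ (Finset.univ : Finset (Fin N))) = Finset.univ :=
  Finset.filter_true_of_mem fun _ _ => Finset.mem_univ _

/-- consistency at `T = univ` with th-7's image count: `dim V(univ, w_N q, k) = C(N, k) · rank (hankel1 K N k q)`. -/
theorem finrank_V_w_letters_univ (k : ℕ) (q : ℕ → K) :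
    finrank K ↥(V K (In N) (Finset.univ : Finset (In N)) (w K N N q) k) = N.choose k * (hankel1 K N k q).rank := by
  have h := finrank_V_w_letters K (Finset.univ : Finset (Fin N)) k q
  rwa [letters_univ, Finset.card_univ, Fintype.card_fin] at h

/-! ## §372. The Hankel matrix eliminated, for pair sets -/

/-- **`C(N, k) · (C(2|T|, k) − dim (Kr(univ, w_N q, k) ⊓ Sp(pairs ⊆ T))) = C(|T|, k) · (C(2N, k) − dim Kr(univ, w_N q, k))`** — the codimension of the kernel on the forms of the
pairs of `T` is the full codimension scaled by `C(|T|,k) : C(N,k)` (every `T`, `k`, `q`, field). -/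
theorem choose_mul_codim_pairs_eq (T : Finset (Fin N)) (k : ℕ) (q : ℕ → K) :
    N.choose k * ((T.card + T.card).choose k - finrank K ↥(Kr K (Finset.univ : Finset (In N)) (w K N N q) k ⊓ Sp K (fun s : Finset (In N) => ∀ i ∈ s, pr i ∈ T)))
      = T.card.choose k * ((N + N).choose k - finrank K ↥(Kr K (Finset.univ : Finset (In N)) (w K N N q) k)) := by
  have h1 := finrank_Kr_w_inf_Sp_pairs_add K T k q
  have h2 := finrank_Kr_w_Dm_top K (N := N) k q
  have e1 : (T.card + T.card).choose k - finrank K ↥(Kr K (Finset.univ : Finset (In N)) (w K N N q) k ⊓ Sp K (fun s : Finset (In N) => ∀ i ∈ s, pr i ∈ T))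
      = T.card.choose k * (hankel1 K N k q).rank := by omega
  have e2 : (N + N).choose k - finrank K ↥(Kr K (Finset.univ : Finset (In N)) (w K N N q) k) = N.choose k * (hankel1 K N k q).rank := by omega
  rw [e1, e2]
  ring

/-- **two pair sets: `C(|T'|, k) · codim_T = C(|T|, k) · codim_{T'}`** (the kernel codimensions on the forms of the pairs of `T` and of `T'` are in the ratio `C(|T|,k) : C(|T'|,k)`). -/
theorem choose_mul_codim_pairs_eq_pairs (T T' : Finset (Fin N)) (k : ℕ) (q : ℕ → K) :
    T'.card.choose k * ((T.card + T.card).choose k - finrank K ↥(Kr K (Finset.univ : Finset (In N)) (w K N N q) k ⊓ Sp K (fun s : Finset (In N) => ∀ i ∈ s, pr i ∈ T)))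
      = T.card.choose k * ((T'.card + T'.card).choose k
          - finrank K ↥(Kr K (Finset.univ : Finset (In N)) (w K N N q) k ⊓ Sp K (fun s : Finset (In N) => ∀ i ∈ s, pr i ∈ T'))) := by
  have h1 := finrank_Kr_w_inf_Sp_pairs_add K T k q
  have h1' := finrank_Kr_w_inf_Sp_pairs_add K T' k q
  have e1 : (T.card + T.card).choose k - finrank K ↥(Kr K (Finset.univ : Finset (In N)) (w K N N q) k ⊓ Sp K (fun s : Finset (In N) => ∀ i ∈ s, pr i ∈ T))
      = T.card.choose k * (hankel1 K N k q).rank := by omega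
  have e1' : (T'.card + T'.card).choose k - finrank K ↥(Kr K (Finset.univ : Finset (In N)) (w K N N q) k ⊓ Sp K (fun s : Finset (In N) => ∀ i ∈ s, pr i ∈ T'))
      = T'.card.choose k * (hankel1 K N k q).rank := by omega
  rw [e1, e1']
  ring

/-- **the image form: `C(|T'|, k) · dim V(letters T, w_N q, k) = C(|T|, k) · dim V(letters T', w_N q, k)`** (every two pair sets, every `k`, `q`, field). -/
theorem choose_mul_finrank_V_w_letters (T T' : Finset (Fin N)) (k : ℕ) (q : ℕ → K) :
    T'.card.choose k * finrank K ↥(V K (In N) (Finset.univ.filter fun i : In N => pr i ∈ T) (w K N N q) k)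
      = T.card.choose k * finrank K ↥(V K (In N) (Finset.univ.filter fun i : In N => pr i ∈ T') (w K N N q) k) := by
  rw [finrank_V_w_letters, finrank_V_w_letters]
  ring

end Summit.Ventures.HSemireg.Wedge.HankelOuter
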